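import Summits.AnomalousDissipation.AnomalousDissipation.Theorems.SolenoidalFractalHomogenisationLagrangianStepD1ResidueCertSocket
import Summits.AnomalousDissipation.AnomalousDissipation.Theorems.SolenoidalFractalHomogenisationCubatureMoments
import HarnessLib

/-!
# TAIL-CERT — certificate spine for the v17 stub `stub_D1_residueTail` (K1L_D, stmt-AnomalousDissipation-27980)

Planner `ad-ideate-p5` g14 «profile», TAKES-p5-g14 T1 (tenure ad-ideate-p1 g26, 2026-08-29T02:22:46Z).  Numbers of record: `tailcert.py`
(rigorous fraction-interval arithmetic; memo `Lines/onelevel-D1-tail-cert.md`).  Registered target (registry v17, `Lines/onelevel_v17.lean`):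

  `stub_D1_residueTail : ∀ ν ∈ Ioc 0 νB₁, ∀ S, NearIso S (10/11) (11/10) → ∀ τ ∈ Icc 0 (1/20), OddSectorial S τ →
      RelSmall (Sideband.psiStar cubatureWord MB MB_pos ν S − excQS cubatureWord MB S − pairQS S) (excQS cubatureWord MB S) (1/200000)`.

THE CERTIFICATE.  Write the bilinear symbol of the tail as the slot-pair double sum it is by definition of `psiStar` (source slot `j'`,
pickup slot `j`; `excQS` is the diagonal fresh part, `pairQS` the colinear-adjacent fresh part — prover ad-sawtooth-k1loc-p1 g12, lane A1):

  `bsymb (psiStar − excQS − pairQS) (k;p,q) = Σ_{j j'} (e_j·k)(e_{j'}·k) · F_{jj'}(p,q)`.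

If every slot-pair form obeys the ν-FREE bound (lane A4; cases A–E of the memo, every factor a landed `Sideband*` lemma + the off-fibre /
support lemma for the 13 adjacent non-colinear successions)

  `|F_{jj'}(p,q)| ≤ gTab j j' · |P_j p| · |P_{j'} q|`,   `gTab j j' = G₀ · Apick j · Bst j' · exp(−θmin)`,

with `G₀ = 1/(16π⁴·3720)`, `Apick j = √2·τ_j·(2/θ_j²)/(2|m_j|)` (pickup integral, tent factor `K(θ) ≤ 2/θ²`), `Bst j' = 11/(5|m_{j'}|)`
(`‖response‖ ≤ 8π|α|/r`), `θ_j = 4π²(10/11)·MB·τ_j = r·L_j ∈ {28.7, 91.9, 174.4}`, `θmin = 32π²/11`, then ONE weighted Cauchy–Schwarz over the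
676 ordered pairs (`sq_le_of_slotPair`) gives `bsymb² ≤ ε_F²·N̄(k,p)·N̄(k,q)` with `ε_F² = Σ_{jj'} gTab²/(w_j w_{j'})`, `w_j = slotCoef_j·nC_j`, and
`frob_gTab_le` PROVES `ε_F² ≤ (1/23)²` (true value `ε_F = 1.24·10⁻⁷`; Lean chain: `exp(−θmin) ≤ 10⁻¹²`, `π² ∈ [9.8696, 9.8697]`, per-slot
class-3 bounds `UA = 12·10⁸`, `UB = 44·10¹²`), so the landed socket `D1ResidueCert.relSmall_of_Nbar` (ε·ρP = (1/23)·(115/10⁶) = 1/200000) yields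
the registered text: **`residueTail_of_slotPairBounds`** (and `D1Residue_of_slotPairBounds` = the v16 `stub_D1_residue` text via
`D1Residue_of_Nbar_tail`).  A cruder table `gTabC` (pickup WITHOUT in-slot decay, `K → 1/2`) is certified too (`frob_gTabC_le`, ε_F
≤ 1/23: true `8.3·10⁻⁴`, certified `≤ 7.9·10⁻³`), so lane A4 may use the crudest landed bounds.  No sorry; no new definition of substance (tables are abbreviations); NOT a proof of
`stub_D1_residueTail` (the structure identity and the per-pair bounds are p1 g12's A1/A4), of K1L_D or of AD.  Rung F-D1.A0.
-/

set_option linter.dupNamespace false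

namespace Summit.AnomalousDissipation.AnomalousDissipation.Cruxes.LagrangianRenormalisationStep.D1TailCert

open Summit.AnomalousDissipation.AnomalousDissipation.Theorems
open Summit.AnomalousDissipation.AnomalousDissipation.Theorems.SolenoidalFractalHomogenisation.LagrangianStep
open Summit.AnomalousDissipation.AnomalousDissipation.Theorems.SolenoidalFractalHomogenisation.LagrangianStep.WCrossing
open Summit.AnomalousDissipation.AnomalousDissipation.Theorems.SolenoidalFractalHomogenisation.LagrangianStep.WEvenCert
open Summit.AnomalousDissipation.AnomalousDissipation.Theorems.SolenoidalFractalHomogenisation.LagrangianStep.D1ResidueCert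
open Literature.Analysis Literature.Analysis.FluidPDE Literature.Analysis.FunctionSpaces
open Set Real

noncomputable section

/-! ## §1 The ν-free constants of the tail bound -/

/-- Per-slot decay exponent `θ_j = r·L_j = 4π²(10/11)·MB·τ_j` (`r = min γ₁ (4π²·lo') = 4π²ν(10/11)` for `ν ≤ 1/40`, `L_j = MB τ_j/ν`): ν-free. -/
def θs (j : Fin 26) : ℝ := 4 * π ^ 2 * (10 / 11) * MB * (cubatureWord.phase j).τ

/-- The smallest slot exponent `θmin = 4π²(10/11)·MB·40 = 32π²/11 ≈ 28.71` (class `|m|² = 1`). -/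
def θmin : ℝ := 4 * π ^ 2 * (10 / 11) * MB * 40

/-- Global prefactor `G₀ = 1/(16π⁴·P)`, `P = cubatureWord.period = 3720`: `(ν/4π²)·(1/P₁)·L_j·(1/r)` with `P₁ = P·MB/ν`, `L_j = MBτ_j/ν`,
`1/r = 11/(10·4π²ν)` leaves `τ_j·(11/10)/(16π⁴ P)` — the ν's cancel exactly. -/
def G0 : ℝ := 1 / (16 * π ^ 4 * cubatureWord.period)

/-- Pickup constant `Apick j = √2·τ_j·(2/θ_j²)/(2|m_j|)`: `(1/L_j)·∫_{slot j} ‖feedback_j(t)‖ e^{−r(t − start_j)} dt ≤ (√2/(2|m_j|))·K(θ_j)`,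
`K(θ) = 2(1−e^{−θ/2})²/θ² ≤ 2/θ²` (tent envelope, `laplace_trapezoid_eq`), `2π|α_j|·√2 = √2/(2|m_j|)`. -/
def Apick (j : Fin 26) : ℝ :=
  Real.sqrt 2 * (cubatureWord.phase j).τ * (2 / θs j ^ 2) / (2 * ‖Torus.latticeVec (cubatureWord.phase j).m‖)

/-- CRUDE pickup constant `ApickC j = √2·τ_j·(1/2)/(2|m_j|)` (`∫ env = L_j/2`, no in-slot decay used). -/
def ApickC (j : Fin 26) : ℝ :=
  Real.sqrt 2 * (cubatureWord.phase j).τ * (1 / 2) / (2 * ‖Torus.latticeVec (cubatureWord.phase j).m‖)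

/-- State constant `Bst j' = 11/(5|m_{j'}|)`: `‖response_{j'}(t)‖ ≤ 8π|α_{j'}|/r = (11/(5|m_{j'}|))·(1/(4π²ν))` (`Sideband.norm_response_le`). -/
def Bst (j : Fin 26) : ℝ := 11 / (5 * ‖Torus.latticeVec (cubatureWord.phase j).m‖)

/-- THE TABLE OF RECORD: `gTab j j' = G₀·Apick j·Bst j'·e^{−θmin}` (pickup slot `j`, source slot `j'`). -/
def gTab (j j' : Fin 26) : ℝ := G0 * Apick j * Bst j' * Real.exp (-θmin)

/-- The crude table `gTabC j j' = G₀·ApickC j·Bst j'·e^{−θmin}`. -/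
def gTabC (j j' : Fin 26) : ℝ := G0 * ApickC j * Bst j' * Real.exp (-θmin)

/-- Slot weight of `N̄`: `w_j = slotCoef_j·nC_j` (`N̄(k,p) = Σ_j w_j (e_j·k)² |P_j p|²`). -/
def wN (j : Fin 26) : ℝ := slotCoef cubatureWord j * nC j

/-! ## §2 Slot data by class -/

/-- Class data of the 26 slots: `(|m_j|², τ_j) ∈ {(1,40), (2,128), (3,243)}` (the `decide`d table `slots_table`). -/
theorem class_data (j : Fin 26) :
    (Mq (slots j) = 1 ∧ (cubatureWord.phase j).τ = 40) ∨ (Mq (slots j) = 2 ∧ (cubatureWord.phase j).τ = 128) ∨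
      (Mq (slots j) = 3 ∧ (cubatureWord.phase j).τ = 243) := by
  have h := (slots_table j).1
  have hτ : (cubatureWord.phase j).τ = ((slots j).τ : ℝ) := (cubatureWord_phase j).2.2
  rcases h with ⟨hm, ht⟩ | ⟨hm, ht⟩ | ⟨hm, ht⟩
  · refine Or.inl ⟨?_, by rw [hτ, ht]; norm_num⟩
    unfold Mq; exact_mod_cast hm
  · refine Or.inr (Or.inl ⟨?_, by rw [hτ, ht]; norm_num⟩)
    unfold Mq; exact_mod_cast hm
  · refine Or.inr (Or.inr ⟨?_, by rw [hτ, ht]; norm_num⟩)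
    unfold Mq; exact_mod_cast hm

/-- `‖m_j‖² = Mq (slots j)`. -/
theorem norm_m_sq (j : Fin 26) : ‖Torus.latticeVec (cubatureWord.phase j).m‖ ^ 2 = Mq (slots j) := by
  rw [cubatureWord_norm_m_sq]; rfl

/-- `Mq (slots j) > 0`. -/
theorem Mq_pos (j : Fin 26) : 0 < Mq (slots j) := by
  rcases class_data j with ⟨h, -⟩ | ⟨h, -⟩ | ⟨h, -⟩ <;> rw [h] <;> norm_num

/-- `τ_j > 0`. -/
theorem tau_pos (j : Fin 26) : 0 < (cubatureWord.phase j).τ := by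
  rcases class_data j with ⟨-, h⟩ | ⟨-, h⟩ | ⟨-, h⟩ <;> rw [h] <;> norm_num

/-- `‖m_j‖ > 0`. -/
theorem norm_m_pos (j : Fin 26) : 0 < ‖Torus.latticeVec (cubatureWord.phase j).m‖ := by
  have h := norm_m_sq j
  have hM := Mq_pos j
  by_contra hc
  have h0 : ‖Torus.latticeVec (cubatureWord.phase j).m‖ = 0 := le_antisymm (not_lt.mp hc) (norm_nonneg _)
  rw [h0] at h; simp at h; linarith

/-- `π² ∈ [9.8696, 9.8697]`. -/
theorem pi_sq_encl : (9.8696 : ℝ) ≤ π ^ 2 ∧ π ^ 2 ≤ 9.8697 := by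
  have h1 := Real.pi_gt_d6
  have h2 := Real.pi_lt_d6
  constructor <;> nlinarith [Real.pi_pos]

/-- `π⁴ ∈ [97, 97.42]`. -/
theorem pi_four_encl : (97 : ℝ) ≤ π ^ 4 ∧ π ^ 4 ≤ 97.42 := by
  obtain ⟨h1, h2⟩ := pi_sq_encl
  have e : π ^ 4 = π ^ 2 * π ^ 2 := by ring
  rw [e]; constructor <;> nlinarith

/-- The slot weight in closed form: `w_j = τ_j·nC_j/(119040·|m_j|⁴·π⁴)` (`119040 = 2·16·3720`). -/
theorem wN_eq (j : Fin 26) : wN j = (cubatureWord.phase j).τ * nC j / (119040 * Mq (slots j) ^ 2 * π ^ 4) := by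
  unfold wN slotCoef
  rw [period_cubatureWord]
  have h4 : (2 * π * ‖Torus.latticeVec (cubatureWord.phase j).m‖) ^ 4 = 16 * π ^ 4 * Mq (slots j) ^ 2 := by
    rw [← norm_m_sq]; ring
  rw [h4]
  have hπ : π ^ 4 ≠ 0 := by positivity
  have hM : Mq (slots j) ^ 2 ≠ 0 := by have := Mq_pos j; positivity
  field_simp
  ring

/-- `w_j > 0`. -/
theorem wN_pos (j : Fin 26) : 0 < wN j := by
  rw [wN_eq]
  have := tau_pos j; have := nC_pos j; have := Mq_pos j
  positivity

/-! ## §3 The finite certificate: one weighted Cauchy–Schwarz over the 676 ordered slot pairs -/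

/-- **Slot-pair Cauchy–Schwarz.**  If `b = Σ_{jj'} (e_j·k)(e_{j'}·k) F_{jj'}` with `|F_{jj'}| ≤ g_{jj'}·|P_j p|·|P_{j'} q|` and
`Σ_{jj'} g_{jj'}²/(w_j w_{j'}) ≤ ε²`, then `b² ≤ ε²·N̄(k,p)·N̄(k,q)` — the hypothesis `hR` of the socket `relSmall_of_Nbar`. -/
theorem sq_le_of_slotPair {b : ℝ} {k p q : Fin 3 → ℝ} {F g : Fin 26 → Fin 26 → ℝ} {ε : ℝ}
    (hb : b = ∑ j, ∑ j', ek j k * ek j' k * F j j')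
    (hF : ∀ j j', |F j j'| ≤ g j j' * (Real.sqrt (PpSq j p) * Real.sqrt (PpSq j' q)))
    (hg : ∑ j, ∑ j', g j j' ^ 2 / (wN j * wN j') ≤ ε ^ 2) :
    b ^ 2 ≤ ε ^ 2 * (Nbar k p * Nbar k q) := by
  have hw : ∀ j, 0 < wN j := wN_pos
  have hsw : ∀ j, 0 < Real.sqrt (wN j) := fun j => Real.sqrt_pos.mpr (hw j)
  set X : Fin 26 → ℝ := fun j => Real.sqrt (wN j) * (|ek j k| * Real.sqrt (PpSq j p)) with hX
  set Y : Fin 26 → ℝ := fun j => Real.sqrt (wN j) * (|ek j k| * Real.sqrt (PpSq j q)) with hY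
  set u : Fin 26 → Fin 26 → ℝ := fun j j' => g j j' / (Real.sqrt (wN j) * Real.sqrt (wN j')) with hu
  have habs : |b| ≤ ∑ j, ∑ j', u j j' * (X j * Y j') := by
    rw [hb]
    refine (Finset.abs_sum_le_sum_abs _ _).trans (Finset.sum_le_sum fun j _ =>
      (Finset.abs_sum_le_sum_abs _ _).trans (Finset.sum_le_sum fun j' _ => ?_))
    rw [abs_mul, abs_mul]
    have hnn : 0 ≤ |ek j k| * |ek j' k| := by positivity
    calc |ek j k| * |ek j' k| * |F j j'|
        ≤ |ek j k| * |ek j' k| * (g j j' * (Real.sqrt (PpSq j p) * Real.sqrt (PpSq j' q))) :=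
          mul_le_mul_of_nonneg_left (hF j j') hnn
      _ = u j j' * (X j * Y j') := by
          simp only [hu, hX, hY]
          have h1 : Real.sqrt (wN j) ≠ 0 := (hsw j).ne'
          have h2 : Real.sqrt (wN j') ≠ 0 := (hsw j').ne'
          field_simp
  have hCS := Finset.sum_mul_sq_le_sq_mul_sq (Finset.univ : Finset (Fin 26 × Fin 26))
    (fun x => u x.1 x.2) (fun x => X x.1 * Y x.2)
  have e1 : ∑ x : Fin 26 × Fin 26, u x.1 x.2 * (X x.1 * Y x.2) = ∑ j, ∑ j', u j j' * (X j * Y j') :=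
    Fintype.sum_prod_type _
  have e2 : ∑ x : Fin 26 × Fin 26, (u x.1 x.2) ^ 2 = ∑ j, ∑ j', g j j' ^ 2 / (wN j * wN j') := by
    rw [Fintype.sum_prod_type]
    refine Finset.sum_congr rfl fun j _ => Finset.sum_congr rfl fun j' _ => ?_
    simp only [hu]
    rw [div_pow, mul_pow, Real.sq_sqrt (hw j).le, Real.sq_sqrt (hw j').le]
  have e3 : ∑ x : Fin 26 × Fin 26, (X x.1 * Y x.2) ^ 2 = Nbar k p * Nbar k q := by
    rw [Fintype.sum_prod_type]
    have : ∑ j : Fin 26, ∑ j' : Fin 26, (X j * Y j') ^ 2 = (∑ j, X j ^ 2) * (∑ j', Y j' ^ 2) := by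
      rw [Finset.sum_mul_sum]
      exact Finset.sum_congr rfl fun j _ => Finset.sum_congr rfl fun j' _ => by ring
    rw [this]
    have hsq : ∀ r : Fin 3 → ℝ, ∑ j, (Real.sqrt (wN j) * (|ek j k| * Real.sqrt (PpSq j r))) ^ 2 = Nbar k r := fun r => by
      unfold Nbar
      exact Finset.sum_congr rfl fun j _ => by
        rw [mul_pow, mul_pow, Real.sq_sqrt (hw j).le, sq_abs, Real.sq_sqrt (PpSq_nonneg _ _)]
        unfold wN; ring
    rw [hsq p, hsq q]
  rw [e1, e2, e3] at hCS
  calc b ^ 2 = |b| ^ 2 := (sq_abs b).symm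
    _ ≤ (∑ j, ∑ j', u j j' * (X j * Y j')) ^ 2 := pow_le_pow_left₀ (abs_nonneg b) habs 2
    _ ≤ (∑ j, ∑ j', g j j' ^ 2 / (wN j * wN j')) * (Nbar k p * Nbar k q) := hCS
    _ ≤ ε ^ 2 * (Nbar k p * Nbar k q) :=
        mul_le_mul_of_nonneg_right hg (mul_nonneg (Nbar_nonneg _ _) (Nbar_nonneg _ _))

/-- A table and its transpose have the same Frobenius weight (orientation of the identification is immaterial). -/
theorem frob_transpose (g : Fin 26 → Fin 26 → ℝ) :
    ∑ j, ∑ j', g j' j ^ 2 / (wN j * wN j') = ∑ j, ∑ j', g j j' ^ 2 / (wN j * wN j') := by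
  rw [Finset.sum_comm]
  exact Finset.sum_congr rfl fun j _ => Finset.sum_congr rfl fun j' _ => by rw [mul_comm (wN j')]

/-! ## §4 Numerical enclosures of the constants -/

/-- `exp(−θmin) ≤ 10⁻¹²` (`θmin ≥ 28`, `e^{28} ≥ 2.7182818283^{28} ≥ 10^{12}`; true value `3.39·10⁻¹³`). -/
theorem exp_neg_θmin_le : Real.exp (-θmin) ≤ 1 / 10 ^ 12 := by
  obtain ⟨hlo, -⟩ := pi_sq_encl
  have hθ : (28 : ℝ) ≤ θmin := by unfold θmin MB; nlinarith
  have h1 : Real.exp (-θmin) ≤ Real.exp (-28) := Real.exp_le_exp.mpr (by linarith)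
  have h2 : Real.exp (-(28 : ℝ)) = 1 / Real.exp 1 ^ 28 := by
    rw [Real.exp_neg, one_div, Real.exp_one_pow]; norm_num
  have h3 : (2.7182818283 : ℝ) < Real.exp 1 := Real.exp_one_gt_d9
  have h4 : (10 : ℝ) ^ 12 ≤ Real.exp 1 ^ 28 :=
    le_trans (by norm_num : (10 : ℝ) ^ 12 ≤ 2.7182818283 ^ 28) (pow_le_pow_left₀ (by norm_num) h3.le 28)
  rw [h2] at h1
  exact h1.trans (one_div_le_one_div_of_le (by positivity) h4)

/-- `0 < exp(−θmin)`. -/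
theorem exp_neg_θmin_pos : 0 < Real.exp (-θmin) := Real.exp_pos _

/-- `0 < G₀ ≤ 1/(16·97·3720)`. -/
theorem G0_encl : 0 < G0 ∧ G0 ≤ 1 / (16 * 97 * 3720) := by
  obtain ⟨h4, -⟩ := pi_four_encl
  unfold G0; rw [period_cubatureWord]
  refine ⟨by positivity, ?_⟩
  apply one_div_le_one_div_of_le (by norm_num)
  nlinarith

/-- `θ_j ≥ θlo` by class: `4·9.8696·(10/11)·(1/50)·τ_j ≤ θ_j`. -/
theorem θs_ge (j : Fin 26) : 4 * 9.8696 * (10 / 11) * (1 / 50) * (cubatureWord.phase j).τ ≤ θs j := by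
  obtain ⟨hlo, -⟩ := pi_sq_encl
  have hτ := tau_pos j
  unfold θs MB
  nlinarith

/-- `θ_j > 0`. -/
theorem θs_pos (j : Fin 26) : 0 < θs j := by
  have := tau_pos j; unfold θs MB; positivity

/-- `Apick j² = 8·τ_j²/(θ_j⁴·(4|m_j|²))`. -/
theorem Apick_sq (j : Fin 26) : Apick j ^ 2 = 2 * (cubatureWord.phase j).τ ^ 2 * (2 / θs j ^ 2) ^ 2 / (4 * Mq (slots j)) := by
  unfold Apick
  rw [div_pow, mul_pow, mul_pow, Real.sq_sqrt (by norm_num : (0:ℝ) ≤ 2), mul_pow, norm_m_sq]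
  ring

/-- `ApickC j² = τ_j²/(8|m_j|²)`. -/
theorem ApickC_sq (j : Fin 26) : ApickC j ^ 2 = 2 * (cubatureWord.phase j).τ ^ 2 * (1 / 2) ^ 2 / (4 * Mq (slots j)) := by
  unfold ApickC
  rw [div_pow, mul_pow, mul_pow, Real.sq_sqrt (by norm_num : (0:ℝ) ≤ 2), mul_pow, norm_m_sq]
  ring

/-- `Bst j² = 121/(25|m_j|²)`. -/
theorem Bst_sq (j : Fin 26) : Bst j ^ 2 = 121 / (25 * Mq (slots j)) := by
  unfold Bst
  rw [div_pow, mul_pow, norm_m_sq]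
  ring

/-- Lower bound of the slot weight: `w_j ≥ τ_j·nC_j/(119040·|m_j|⁴·97.42)`. -/
theorem wN_ge (j : Fin 26) : (cubatureWord.phase j).τ * nC j / (119040 * Mq (slots j) ^ 2 * 97.42) ≤ wN j := by
  obtain ⟨-, h4⟩ := pi_four_encl
  rw [wN_eq]
  have hτ := tau_pos j; have hn := nC_pos j; have hM := Mq_pos j
  apply div_le_div_of_nonneg_left (by positivity) (by positivity)
  exact mul_le_mul_of_nonneg_left h4 (by positivity)

/-- Per-class engine: a numerator bound `X ≤ Q` and `Q ≤ U·wlo_class` give `X/w_j ≤ U`. -/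
theorem quot_le_of_class {j : Fin 26} {c t n X Q U : ℝ} (hM : Mq (slots j) = c) (hτ : (cubatureWord.phase j).τ = t)
    (hn : nC j = n) (hX : X ≤ Q) (hQU : Q ≤ U * (t * n / (119040 * c ^ 2 * 97.42))) (hU : 0 ≤ U) : X / wN j ≤ U := by
  have hw := wN_pos j
  have hwlo := wN_ge j
  rw [hM, hτ, hn] at hwlo
  rw [div_le_iff₀ hw]
  exact hX.trans (hQU.trans (mul_le_mul_of_nonneg_left hwlo hU))

/-- The three values of `nC`. -/
theorem nC_of_Mq_one {j : Fin 26} (hM : Mq (slots j) = 1) : nC j = 93 / 1000000 := by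
  unfold nC byClass; norm_num [hM]
theorem nC_of_Mq_two {j : Fin 26} (hM : Mq (slots j) = 2) : nC j = 36 / 100000000 := by
  unfold nC byClass; norm_num [hM]
theorem nC_of_Mq_three {j : Fin 26} (hM : Mq (slots j) = 3) : nC j = 16 / 1000000000 := by
  unfold nC byClass; norm_num [hM]

/-- `Apick j²` below its class value with `θ_j` replaced by the rational `θlo_j`. -/
theorem Apick_sq_le {j : Fin 26} {c t : ℝ} (hM : Mq (slots j) = c) (hτ : (cubatureWord.phase j).τ = t) (ht : 0 < t) (hc : 0 < c) :
    Apick j ^ 2 ≤ 2 * t ^ 2 * (2 / (4 * 9.8696 * (10 / 11) * (1 / 50) * t) ^ 2) ^ 2 / (4 * c) := by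
  have hθ := θs_ge j
  have hθ0 := θs_pos j
  rw [hτ] at hθ
  rw [Apick_sq, hM, hτ]
  have hq : 2 / θs j ^ 2 ≤ 2 / (4 * 9.8696 * (10 / 11) * (1 / 50) * t) ^ 2 :=
    div_le_div_of_nonneg_left (by norm_num) (by positivity) (pow_le_pow_left₀ (by positivity) hθ 2)
  have hq0 : 0 ≤ 2 / θs j ^ 2 := by positivity
  gcongr

/-- **Per-slot pickup quotient** `Apick j²/w_j ≤ UA = 12·10⁸` (values `1.47·10⁷, 2.31·10⁸, 1.14·10⁹` by class). -/
theorem Apick_sq_div_le (j : Fin 26) : Apick j ^ 2 / wN j ≤ 12 * 10 ^ 8 := by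
  rcases class_data j with ⟨hM, hτ⟩ | ⟨hM, hτ⟩ | ⟨hM, hτ⟩
  · exact quot_le_of_class hM hτ (nC_of_Mq_one hM) (Apick_sq_le hM hτ (by norm_num) (by norm_num)) (by norm_num) (by norm_num)
  · exact quot_le_of_class hM hτ (nC_of_Mq_two hM) (Apick_sq_le hM hτ (by norm_num) (by norm_num)) (by norm_num) (by norm_num)
  · exact quot_le_of_class hM hτ (nC_of_Mq_three hM) (Apick_sq_le hM hτ (by norm_num) (by norm_num)) (by norm_num) (by norm_num)

/-- **Per-slot CRUDE pickup quotient** `ApickC j²/w_j ≤ UAC = 7·10¹⁶` (values `6.2·10¹¹, 1.03·10¹⁵, 6.6·10¹⁶` by class). -/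
theorem ApickC_sq_div_le (j : Fin 26) : ApickC j ^ 2 / wN j ≤ 7 * 10 ^ 16 := by
  rcases class_data j with ⟨hM, hτ⟩ | ⟨hM, hτ⟩ | ⟨hM, hτ⟩
  · refine quot_le_of_class hM hτ (nC_of_Mq_one hM) (le_of_eq (ApickC_sq j)) ?_ (by norm_num); rw [hM, hτ]; norm_num
  · refine quot_le_of_class hM hτ (nC_of_Mq_two hM) (le_of_eq (ApickC_sq j)) ?_ (by norm_num); rw [hM, hτ]; norm_num
  · refine quot_le_of_class hM hτ (nC_of_Mq_three hM) (le_of_eq (ApickC_sq j)) ?_ (by norm_num); rw [hM, hτ]; norm_num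

/-- **Per-slot state quotient** `Bst j²/w_j ≤ UB = 44·10¹²` (values `1.5·10¹⁰, 2.4·10¹², 4.33·10¹³` by class). -/
theorem Bst_sq_div_le (j : Fin 26) : Bst j ^ 2 / wN j ≤ 44 * 10 ^ 12 := by
  rcases class_data j with ⟨hM, hτ⟩ | ⟨hM, hτ⟩ | ⟨hM, hτ⟩
  · refine quot_le_of_class hM hτ (nC_of_Mq_one hM) (le_of_eq (Bst_sq j)) ?_ (by norm_num); rw [hM]; norm_num
  · refine quot_le_of_class hM hτ (nC_of_Mq_two hM) (le_of_eq (Bst_sq j)) ?_ (by norm_num); rw [hM]; norm_num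
  · refine quot_le_of_class hM hτ (nC_of_Mq_three hM) (le_of_eq (Bst_sq j)) ?_ (by norm_num); rw [hM]; norm_num

/-! ## §5 The Frobenius weights of the two tables are below `(1/23)²` -/

/-- Generic product-table bound: `g j j' = G₀·A j·B j'·e^{−θmin}` with `A j²/w_j ≤ UA`, `B j²/w_j ≤ UB` ⇒
`Σ_{jj'} g²/(w w') ≤ 676·G₀²·e^{−2θmin}·UA·UB`. -/
theorem frob_product_le {A B : Fin 26 → ℝ} {UA UB : ℝ} (hA : ∀ j, A j ^ 2 / wN j ≤ UA) (hB : ∀ j, B j ^ 2 / wN j ≤ UB) :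
    ∑ j, ∑ j', (G0 * A j * B j' * Real.exp (-θmin)) ^ 2 / (wN j * wN j')
      ≤ 676 * ((G0 * Real.exp (-θmin)) ^ 2 * (UA * UB)) := by
  have hUA : 0 ≤ UA := le_trans (div_nonneg (sq_nonneg _) (wN_pos 0).le) (hA 0)
  have hterm : ∀ j j', (G0 * A j * B j' * Real.exp (-θmin)) ^ 2 / (wN j * wN j')
      ≤ (G0 * Real.exp (-θmin)) ^ 2 * (UA * UB) := fun j j' => by
    have e : (G0 * A j * B j' * Real.exp (-θmin)) ^ 2 / (wN j * wN j')
        = (G0 * Real.exp (-θmin)) ^ 2 * ((A j ^ 2 / wN j) * (B j' ^ 2 / wN j')) := by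
      rw [mul_pow, mul_pow, mul_pow, div_mul_div_comm]; ring
    rw [e]
    refine mul_le_mul_of_nonneg_left ?_ (sq_nonneg _)
    exact mul_le_mul (hA j) (hB j') (div_nonneg (sq_nonneg _) (wN_pos j').le) hUA
  calc ∑ j, ∑ j', (G0 * A j * B j' * Real.exp (-θmin)) ^ 2 / (wN j * wN j')
      ≤ ∑ _j : Fin 26, ∑ _j' : Fin 26, (G0 * Real.exp (-θmin)) ^ 2 * (UA * UB) :=
        Finset.sum_le_sum fun j _ => Finset.sum_le_sum fun j' _ => hterm j j'
    _ = 676 * ((G0 * Real.exp (-θmin)) ^ 2 * (UA * UB)) := by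
        rw [Finset.sum_const, Finset.sum_const, Finset.card_univ, Fintype.card_fin]; simp; ring

/-- `(G₀·e^{−θmin})² ≤ (1/(16·97·3720))²·10⁻²⁴`. -/
theorem G0_exp_sq_le : (G0 * Real.exp (-θmin)) ^ 2 ≤ (1 / (16 * 97 * 3720)) ^ 2 * (1 / 10 ^ 12) ^ 2 := by
  obtain ⟨hG0, hG⟩ := G0_encl
  have he := exp_neg_θmin_le
  have he0 := exp_neg_θmin_pos
  rw [mul_pow]
  exact mul_le_mul (pow_le_pow_left₀ hG0.le hG 2) (pow_le_pow_left₀ he0.le he 2) (by positivity) (by positivity)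

/-- **THE NUMBER OF RECORD: `Σ_{jj'} gTab²/(w_j w_{j'}) ≤ (1/23)²`** (true value `(1.243·10⁻⁷)²`; this chain certifies `≤ (1.1·10⁻⁶)²`). -/
theorem frob_gTab_le : ∑ j, ∑ j', gTab j j' ^ 2 / (wN j * wN j') ≤ (1 / 23) ^ 2 := by
  have h := frob_product_le Apick_sq_div_le Bst_sq_div_le
  have h2 := G0_exp_sq_le
  calc ∑ j, ∑ j', gTab j j' ^ 2 / (wN j * wN j')
      = ∑ j, ∑ j', (G0 * Apick j * Bst j' * Real.exp (-θmin)) ^ 2 / (wN j * wN j') := rfl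
    _ ≤ 676 * ((G0 * Real.exp (-θmin)) ^ 2 * ((12 * 10 ^ 8) * (44 * 10 ^ 12))) := h
    _ ≤ 676 * (((1 / (16 * 97 * 3720)) ^ 2 * (1 / 10 ^ 12) ^ 2) * ((12 * 10 ^ 8) * (44 * 10 ^ 12))) := by
        gcongr
    _ ≤ (1 / 23) ^ 2 := by norm_num

/-- The crude table is certified too: `Σ_{jj'} gTabC²/(w_j w_{j'}) ≤ (1/23)²` (true value `(8.3·10⁻⁴)²`; this chain certifies `≤ (7.9·10⁻³)²`). -/
theorem frob_gTabC_le : ∑ j, ∑ j', gTabC j j' ^ 2 / (wN j * wN j') ≤ (1 / 23) ^ 2 := by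
  have h := frob_product_le ApickC_sq_div_le Bst_sq_div_le
  have h2 := G0_exp_sq_le
  calc ∑ j, ∑ j', gTabC j j' ^ 2 / (wN j * wN j')
      = ∑ j, ∑ j', (G0 * ApickC j * Bst j' * Real.exp (-θmin)) ^ 2 / (wN j * wN j') := rfl
    _ ≤ 676 * ((G0 * Real.exp (-θmin)) ^ 2 * ((7 * 10 ^ 16) * (44 * 10 ^ 12))) := h
    _ ≤ 676 * (((1 / (16 * 97 * 3720)) ^ 2 * (1 / 10 ^ 12) ^ 2) * ((7 * 10 ^ 16) * (44 * 10 ^ 12))) := by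
        gcongr
    _ ≤ (1 / 23) ^ 2 := by norm_num

/-- Transposed tables (source/pickup roles swapped in the identification) are certified by `frob_transpose`. -/
theorem frob_gTab_transpose_le : ∑ j, ∑ j', gTab j' j ^ 2 / (wN j * wN j') ≤ (1 / 23) ^ 2 := by
  rw [frob_transpose]; exact frob_gTab_le

/-- `gTab ≥ 0`, `gTabC ≥ 0`. -/
theorem gTab_nonneg (j j' : Fin 26) : 0 ≤ gTab j j' ∧ 0 ≤ gTabC j j' := by
  obtain ⟨hG0, -⟩ := G0_encl
  have h1 := norm_m_pos j; have h2 := norm_m_pos j'; have h3 := tau_pos j; have h4 := θs_pos j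
  unfold gTab gTabC Apick ApickC Bst
  constructor <;> positivity

/-! ## §6 Composition with the landed socket: the registered texts from the slot-pair bounds -/

/-- `(1/23)·ρP = 1/200000` (`ρP = 115/10⁶`): the socket size at `ε = 1/23` is exactly the registered `ρT`. -/
theorem one_div_23_mul_ρP : (1 / 23 : ℝ) * ρP = 1 / 200000 := by unfold ρP; norm_num

/-- **Generic composition.**  ANY table `g` with Frobenius weight `≤ (1/23)²`: a slot-pair presentation of `bsymb R` with per-pair bounds
`|F_{jj'}(p,q)| ≤ g j j'·|P_j p|·|P_{j'} q|` makes `R` `RelSmall` of size `1/200000` relative to `excQS` on the sectorial block window. -/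
theorem relSmall_tail_of_table {R S : T4} {g : Fin 26 → Fin 26 → ℝ} (hg : ∑ j, ∑ j', g j j' ^ 2 / (wN j * wN j') ≤ (1 / 23) ^ 2)
    (hS : Torus.NearIso S (10 / 11) (11 / 10)) {τ : ℝ} (hτ : τ ∈ Set.Icc (0:ℝ) (1 / 20)) (hodd : OddSectorial S τ)
    (F : (Fin 3 → ℝ) → (Fin 3 → ℝ) → Fin 26 → Fin 26 → ℝ)
    (hstruct : ∀ k p q : Fin 3 → ℝ, ∑ i, p i * k i = 0 → ∑ i, q i * k i = 0 →
      Torus.bsymb R k p q = ∑ j, ∑ j', ek j k * ek j' k * F p q j j')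
    (hbound : ∀ p q : Fin 3 → ℝ, ∀ j j', |F p q j j'| ≤ g j j' * (Real.sqrt (PpSq j p) * Real.sqrt (PpSq j' q))) :
    RelSmall R (excQS cubatureWord MB S) (1 / 200000) := by
  rw [← one_div_23_mul_ρP]
  exact relSmall_of_Nbar hS hτ hodd fun k p q hp hq => sq_le_of_slotPair (hstruct k p q hp hq) (hbound p q) hg

/-- **THE REGISTERED v17 TEXT `stub_D1_residueTail` FROM THE SLOT-PAIR BOUNDS (table of record `gTab`).**
`hstruct` = lane A1 (the slot-pair presentation of the tail's bilinear symbol on transverse pairs; `F` may depend on `ν`, `S`),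
`hbound` = lane A4 (the 676 per-pair bounds, cases A–E of the memo).  Conclusion: the registered stub text verbatim. -/
theorem residueTail_of_slotPairBounds
    (F : ℝ → T4 → (Fin 3 → ℝ) → (Fin 3 → ℝ) → Fin 26 → Fin 26 → ℝ)
    (hstruct : ∀ ν ∈ Set.Ioc 0 νB₁, ∀ S : Torus.Visc4 (Fin 3), Torus.NearIso S (10 / 11) (11 / 10) →
      ∀ τ ∈ Set.Icc (0:ℝ) (1 / 20), OddSectorial S τ → ∀ k p q : Fin 3 → ℝ, ∑ i, p i * k i = 0 → ∑ i, q i * k i = 0 →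
        Torus.bsymb (Sideband.psiStar cubatureWord MB MB_pos ν S - excQS cubatureWord MB S - pairQS S) k p q
          = ∑ j, ∑ j', ek j k * ek j' k * F ν S p q j j')
    (hbound : ∀ ν ∈ Set.Ioc 0 νB₁, ∀ S : Torus.Visc4 (Fin 3), Torus.NearIso S (10 / 11) (11 / 10) →
      ∀ τ ∈ Set.Icc (0:ℝ) (1 / 20), OddSectorial S τ →
        ∀ p q : Fin 3 → ℝ, ∀ j j', |F ν S p q j j'| ≤ gTab j j' * (Real.sqrt (PpSq j p) * Real.sqrt (PpSq j' q))) :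
    ∀ ν ∈ Set.Ioc 0 νB₁, ∀ S : Torus.Visc4 (Fin 3), Torus.NearIso S (10 / 11) (11 / 10) →
      ∀ τ ∈ Set.Icc (0:ℝ) (1 / 20), OddSectorial S τ →
        RelSmall (Sideband.psiStar cubatureWord MB MB_pos ν S - excQS cubatureWord MB S - pairQS S)
          (excQS cubatureWord MB S) (1 / 200000) :=
  fun ν hν S hS τ hτ hodd =>
    relSmall_tail_of_table frob_gTab_le hS hτ hodd (F ν S) (hstruct ν hν S hS τ hτ hodd) (hbound ν hν S hS τ hτ hodd)

/-- The same with the CRUDE table `gTabC` (pickup bound without in-slot decay). -/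
theorem residueTail_of_slotPairBounds_crude
    (F : ℝ → T4 → (Fin 3 → ℝ) → (Fin 3 → ℝ) → Fin 26 → Fin 26 → ℝ)
    (hstruct : ∀ ν ∈ Set.Ioc 0 νB₁, ∀ S : Torus.Visc4 (Fin 3), Torus.NearIso S (10 / 11) (11 / 10) →
      ∀ τ ∈ Set.Icc (0:ℝ) (1 / 20), OddSectorial S τ → ∀ k p q : Fin 3 → ℝ, ∑ i, p i * k i = 0 → ∑ i, q i * k i = 0 →
        Torus.bsymb (Sideband.psiStar cubatureWord MB MB_pos ν S - excQS cubatureWord MB S - pairQS S) k p q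
          = ∑ j, ∑ j', ek j k * ek j' k * F ν S p q j j')
    (hbound : ∀ ν ∈ Set.Ioc 0 νB₁, ∀ S : Torus.Visc4 (Fin 3), Torus.NearIso S (10 / 11) (11 / 10) →
      ∀ τ ∈ Set.Icc (0:ℝ) (1 / 20), OddSectorial S τ →
        ∀ p q : Fin 3 → ℝ, ∀ j j', |F ν S p q j j'| ≤ gTabC j j' * (Real.sqrt (PpSq j p) * Real.sqrt (PpSq j' q))) :
    ∀ ν ∈ Set.Ioc 0 νB₁, ∀ S : Torus.Visc4 (Fin 3), Torus.NearIso S (10 / 11) (11 / 10) →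
      ∀ τ ∈ Set.Icc (0:ℝ) (1 / 20), OddSectorial S τ →
        RelSmall (Sideband.psiStar cubatureWord MB MB_pos ν S - excQS cubatureWord MB S - pairQS S)
          (excQS cubatureWord MB S) (1 / 200000) :=
  fun ν hν S hS τ hτ hodd =>
    relSmall_tail_of_table frob_gTabC_le hS hτ hodd (F ν S) (hstruct ν hν S hS τ hτ hodd) (hbound ν hν S hS τ hτ hodd)

/-- **The v16 `stub_D1_residue` text** (all `a > 0`) from the same two inputs, through `D1ResidueCert.D1Residue_of_Nbar_tail` (ε = 1/23). -/
theorem D1Residue_of_slotPairBounds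
    (F : ℝ → T4 → (Fin 3 → ℝ) → (Fin 3 → ℝ) → Fin 26 → Fin 26 → ℝ)
    (hstruct : ∀ ν ∈ Set.Ioc 0 νB₁, ∀ S : Torus.Visc4 (Fin 3), Torus.NearIso S (10 / 11) (11 / 10) →
      ∀ τ ∈ Set.Icc (0:ℝ) (1 / 20), OddSectorial S τ → ∀ k p q : Fin 3 → ℝ, ∑ i, p i * k i = 0 → ∑ i, q i * k i = 0 →
        Torus.bsymb (Sideband.psiStar cubatureWord MB MB_pos ν S - excQS cubatureWord MB S - pairQS S) k p q
          = ∑ j, ∑ j', ek j k * ek j' k * F ν S p q j j')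
    (hbound : ∀ ν ∈ Set.Ioc 0 νB₁, ∀ S : Torus.Visc4 (Fin 3), Torus.NearIso S (10 / 11) (11 / 10) →
      ∀ τ ∈ Set.Icc (0:ℝ) (1 / 20), OddSectorial S τ →
        ∀ p q : Fin 3 → ℝ, ∀ j j', |F ν S p q j j'| ≤ gTab j j' * (Real.sqrt (PpSq j p) * Real.sqrt (PpSq j' q))) :
    ∀ a > (0:ℝ), ∀ ν ∈ Set.Ioc 0 νB₁, ∀ S : Torus.Visc4 (Fin 3), Torus.NearIso S (10 / 11) (11 / 10) →
      ∀ τ ∈ Set.Icc (0:ℝ) (1 / 20), OddSectorial S τ →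
        RelSmall (ΨB₁ a ν S - ΦB a S) (ΦB a S) ρB :=
  D1Residue_of_Nbar_tail (ε := 1 / 23) (by norm_num) le_rfl fun ν hν S hS τ hτ hodd k p q hp hq =>
    sq_le_of_slotPair (hstruct ν hν S hS τ hτ hodd k p q hp hq) (hbound ν hν S hS τ hτ hodd p q) frob_gTab_le

/-! ## §7 Helpers for lane A4 (the ν-bookkeeping of the per-pair bounds) -/

/-- For `0 < ν ≤ 1/40` the dissipativity rate `min γ₁ (4π²·lo')` with `γ₁ = 1`, `lo' = ν·(10/11)` is the viscous one. -/
theorem min_one_viscRate {ν : ℝ} (hν : ν ∈ Set.Ioc (0:ℝ) (1 / 40)) :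
    min (1:ℝ) (4 * π ^ 2 * (ν * (10 / 11))) = 4 * π ^ 2 * (ν * (10 / 11)) := by
  obtain ⟨-, hhi⟩ := pi_sq_encl
  refine min_eq_right ?_
  have := hν.2
  nlinarith [Real.pi_pos]

/-- The per-slot exponent: `r·L_j = θ_j` with `r = 4π²ν(10/11)`, `L_j = MB·τ_j/ν`. -/
theorem viscRate_mul_slotLen {ν : ℝ} (hν : 0 < ν) (j : Fin 26) :
    4 * π ^ 2 * (ν * (10 / 11)) * (MB * (cubatureWord.phase j).τ / ν) = θs j := by
  unfold θs; field_simp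

/-- Every slot exponent dominates `θmin`: `θmin ≤ θ_j` (so `e^{−θ_j} ≤ e^{−θmin}` for every full slot crossed). -/
theorem θmin_le_θs (j : Fin 26) : θmin ≤ θs j := by
  unfold θmin θs MB
  have hπ : 0 < π ^ 2 := by positivity
  rcases class_data j with ⟨-, h⟩ | ⟨-, h⟩ | ⟨-, h⟩ <;> rw [h] <;> nlinarith

/-- `e^{−θ_j} ≤ e^{−θmin}`. -/
theorem exp_neg_θs_le (j : Fin 26) : Real.exp (-θs j) ≤ Real.exp (-θmin) :=
  Real.exp_le_exp.mpr (neg_le_neg (θmin_le_θs j))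

/-- A sum of slot exponents over a NONEMPTY set of crossed slots dominates `θmin`. -/
theorem θmin_le_sum {s : Finset (Fin 26)} (hs : s.Nonempty) : θmin ≤ ∑ j ∈ s, θs j := by
  obtain ⟨i, hi⟩ := hs
  calc θmin ≤ θs i := θmin_le_θs i
    _ ≤ ∑ j ∈ s, θs j := Finset.single_le_sum (fun j _ => (θs_pos j).le) hi

/-- The tent Laplace factor is below `2/c²`: `2(1 − e^{−c/2})²/c² ≤ 2/c²` for `c > 0`. -/
theorem tentK_le {c : ℝ} (hc : 0 < c) : 2 * (1 - Real.exp (-(c / 2))) ^ 2 / c ^ 2 ≤ 2 / c ^ 2 := by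
  apply div_le_div_of_nonneg_right _ (by positivity)
  have h0 : 0 ≤ 1 - Real.exp (-(c / 2)) := by
    have : Real.exp (-(c / 2)) ≤ 1 := Real.exp_le_one_iff.mpr (by linarith)
    linarith
  have h1 : 1 - Real.exp (-(c / 2)) ≤ 1 := by have := Real.exp_pos (-(c / 2)); linarith
  nlinarith

/-- The global prefactor assembled from the ν-dependent pieces: `(ν/4π²)·(1/P₁)·L_j·(1/r) = G₀·τ_j·(11/10)` with `P₁ = P·MB/ν`,
`L_j = MB τ_j/ν`, `r = 4π²ν(10/11)` (`P = cubatureWord.period`). -/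
theorem prefactor_eq {ν : ℝ} (hν : 0 < ν) (j : Fin 26) :
    ν / (4 * π ^ 2) * (1 / (cubatureWord.period * MB / ν)) * (MB * (cubatureWord.phase j).τ / ν) * (1 / (4 * π ^ 2 * (ν * (10 / 11))))
      = G0 * (cubatureWord.phase j).τ * (11 / 10) := by
  unfold G0
  rw [period_cubatureWord]
  have hπ : π ≠ 0 := Real.pi_pos.ne'
  have hM : MB ≠ 0 := MB_pos.ne'
  field_simp
  ring

end

end Summit.AnomalousDissipation.AnomalousDissipation.Cruxes.LagrangianRenormalisationStep.D1TailCert
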